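/-
COR-CM (cell pub-hodgecm2, stage 2 of the Hodge ladder) — count-neutral KERNEL CENSUS TRANSPORT, INTRINSIC FORM, cyclic types (seat
prover-pub-hodgecm2-b23-g33-0, binder prover b23, gen 33; claim INT2-INTRINSIC, HOME/lit/LIT-STATUS.md 2026-08-21T18:02Z; sequel of
`Census/OcticFaceTransport.lean`, `Census/DecicFaceTransport.lean`, `Census/DuodecicFaceTransportCyclic.lean` and of
`CorCM/FaceCensusGroupDictionary.lean`). Theorems only; no definition, no named fact, nothing asserted; seat b30's census dictionaries
(`enum`, `table_spec` / `group_spec`, `conj_spec`) are consumed BY NAME; `Interfaces.lean` (C1), every E term, B01 and `Transposition/*`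
are untouched. HONEST FRAMING (COORDINATOR RULING — HODGE FRAMING CORRECTION, 2026-08-21T11:55:35Z): `HC_CM` is NOT proved, here or
anywhere in the tree. Every closing theorem below is CONDITIONAL on face-period witnesses (for ONE field, on the listed faces); no period
is proved here.
T5 (coordinator ruling 15:33:56Z (3), lead staging l.4095): the DICTIONARY binders of the census transport (`ε`, `hε`, `c`, `hc`, `ε c = Γ.conj`
of the `…_aut` theorems) are DISCHARGED here from «`Gal(K/ℚ)` is generated by `g`» and `[K:ℚ] = n`; the face-reading binders are inhabited in
the kernel (`exists_face_of_generator`); the only remaining hypotheses are the period witnesses on the listed faces = instances of the crux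
(`FacePeriodExists` / B01-S), against which the tree has no `¬` theorem on the universe of record — no contradiction derivable; checker:
self (prover-pub-hodgecm2-b23-g33-0), 2026-08-21T18:40Z.
-/
import Summits.HodgeConjecture.CorCM.FaceCensusGroupDictionary
import Summits.HodgeConjecture.CorCM.Census.OcticFaceTransport
import Summits.HodgeConjecture.CorCM.Census.DecicFaceTransport
import Summits.HodgeConjecture.CorCM.Census.DuodecicFaceTransportCyclic
import HarnessLib

/-!
# Cyclic Galois CM fields of degree 8, 10, 12: field closure from ONE generator (census transport, intrinsic form)

The automorphism-form field-closure theorems `…_octicCyclic_aut`, `…_decicCyclic_aut`, `…_duodecicCyclic_aut` of the census transport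
take an enumeration `ε : Aut(K) ≃ Fin n` multiplicative for seat b30's Cayley table, the conjugation automorphism `c` at `σ₀` and
`ε c = Γ.conj` as hypotheses.  For a Galois CM field `K` with CYCLIC Galois group all of this follows from ONE generator `g` and the
degree: `ε (g ^ k) = k` by Mathlib's `zmodMulEquivOfGenerator` (`FaceCensus.exists_enum_of_generator`), and complex conjugation — an
involution `≠ 1` (`K` is totally complex) — is the unique involution `g ^ (n/2)` of the cyclic group, i.e. reads b30's `Γ.conj`
(`exists_autEnum_of_generator`, one per type).  The generating faces of b30's census then read as EXPLICIT `g`-power data: the common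
base type is the `g`-interval `Φ₀ = {σ₀ ∘ g ^ k | k < n/2}` and the place representatives are `σ₀ ∘ g ^ a`:

* `ℤ/8`  (`[K:ℚ] = 8`):  ONE face `(Φ₀; σ₀, σ₀ ∘ g)`;
* `ℤ/10` (`[K:ℚ] = 10`): THREE faces `(Φ₀; σ₀, σ₀∘g)`, `(Φ₀; σ₀, σ₀∘g²)`, `(Φ₀; σ₀∘g, σ₀∘g³)`;
* `ℤ/12` (`[K:ℚ] = 12`): FIVE faces `(Φ₀; σ₀, σ₀∘g)`, `(Φ₀; σ₀, σ₀∘g²)`, `(Φ₀; σ₀, σ₀∘g³)`, `(Φ₀; σ₀∘g, σ₀∘g³)`, `(Φ₀; σ₀∘g², σ₀∘g³)`.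

Such faces exist for every `K`, `g`, `σ₀` (`exists_face_of_generator`, from `FaceCensus.exists_face_reads` and the place criterion
`FaceCensus.mk_comp_eq_mk_comp_iff`), and ONE period witness per face on the universe of record gives the Hodge conjecture for every
complex abelian variety dominated by a product of CM abelian varieties with CM by subfields of `K` (`…_gen`).  After this file a
lane-(2) field-closure seat supplies exactly: `K`, `[K:ℚ]`, a generator of `Gal(K/ℚ)`, `σ₀`, and the periods.  `HC_CM` is NOT proved
and nothing here produces a period.

References: [cite: Pohlmann1968, Thm. 1]; [cite: Milne1999LefschetzClasses, Thm. 3.2 and Cor. 4.5];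
[cite: Shimura1998, §6.2 Theorem 3 and §6.1 Corollary of Theorem 2 (pp. 41–43)]; [cite: MumfordAV1970, §19 Thm. 1 and p. 169].
-/

noncomputable section

open CategoryTheory NumberField NumberField.ComplexEmbedding
open Literature.AlgebraicGeometry Literature.AlgebraicGeometry.Motives Literature.AlgebraicGeometry.HodgeTheory
open Literature.AlgebraicGeometry.ComplexMultiplication Literature.AlgebraicGeometry.Milne1999
open Literature.NumberTheory.Automorphic
open Literature.NumberTheory.Automorphic.PicardCM
open Summit.HodgeConjecture.CorCM.Domination

namespace Summit.HodgeConjecture.CorCM.OcticFaceTransport.Cyclic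

open Summit.HodgeConjecture.CorCM.Census.FaceSquaresModel (mem)
open Summit.HodgeConjecture.CorCM.Census.OcticFaceSquaresCyclic (Γ enum table_spec conj_spec)

/-- **The dictionary from ONE generator, type `ℤ/8` (cyclic octic; `c = 4`).**  `K` a Galois CM field of degree `8` whose
Galois group is generated by `g`; `σ₀` any base embedding.  Then there is an enumeration `ε : Aut(K) ≃ Fin 8`, multiplicative for seat b30's
Cayley table, reading `g ^ k ↦ k`, under which THE automorphism inducing complex conjugation at `σ₀` reads `Γ.conj = 4` — proved, not
assumed: it is the unique involution `g ^ 4` (`FaceCensus.exists_enum_of_generator`, `FaceCensus.zmod_eight_involution`). [folklore] -/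
theorem exists_autEnum_of_generator (K : CMField) [IsGalois ℚ K] (hK : Module.finrank ℚ (K : Type) = 8)
    {g : ((K : Type) ≃ₐ[ℚ] (K : Type))} (hg : ∀ x, x ∈ Subgroup.zpowers g) (σ₀ : (K : Type) →+* ℂ) :
    ∃ ε : ((K : Type) ≃ₐ[ℚ] (K : Type)) ≃ Fin 8,
      (∀ x y : ((K : Type) ≃ₐ[ℚ] (K : Type)), ε (x * y) = Γ.mul (ε x) (ε y)) ∧ (∀ k : Fin 8, ε (g ^ (k : ℕ)) = k) ∧
      ∀ c : ((K : Type) ≃ₐ[ℚ] (K : Type)), σ₀.comp (c : (K : Type) →+* (K : Type)) = conjugate σ₀ → ε c = Γ.conj := by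
  have hn : Nat.card ((K : Type) ≃ₐ[ℚ] (K : Type)) = 8 := (IsGalois.card_aut_eq_finrank ℚ (K : Type)).trans hK
  obtain ⟨ε, hε, hread, hinv⟩ := FaceCensus.exists_enum_of_generator Γ enum table_spec.1 table_spec.2 hg hn
  refine ⟨ε, hε, fun k => FaceCensus.enum_pow_eq ε hread k, fun c hc => table_spec.2 ?_⟩
  obtain ⟨h0, h2⟩ := hinv c (FaceCensus.conjAut_mul_self σ₀ hc) (FaceCensus.conjAut_ne_one σ₀ hc)
  rw [conj_spec]
  exact FaceCensus.zmod_eight_involution _ h0 h2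

/-- The common base type of the generating representatives, code `15`, is the «`g`-interval» `{k | k < 4}`. [folklore] -/
theorem mem_15_iff : ∀ k : Fin 8, mem k 15 = true ↔ (k : ℕ) < 4 := by decide

/-- **The generating faces exist (non-vacuity), type `ℤ/8`.**  For `K`, `g`, `σ₀` as above there is a CM type `Φ₀` of `K` reading as the
`g`-interval — `σ₀ ∘ g ^ k ∈ Φ₀ ↔ k < 4` (`0 ≤ k < 8`) — and for any two exponents `a, b` at different places (`b ≠ a`, `b ≠ a + 4`) a
rank-four face `(Φ₀; σ₀ ∘ g ^ a, σ₀ ∘ g ^ b)` with exactly these place representatives. [folklore] -/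
theorem exists_face_of_generator (K : CMField) [IsGalois ℚ K] (hK : Module.finrank ℚ (K : Type) = 8)
    {g : ((K : Type) ≃ₐ[ℚ] (K : Type))} (hg : ∀ x, x ∈ Subgroup.zpowers g) (σ₀ : (K : Type) →+* ℂ) (a b : Fin 8)
    (hab : a ≠ b ∧ Γ.mul Γ.conj a ≠ b) :
    ∃ R : Face K, (∀ k : Fin 8, σ₀.comp ((g ^ (k : ℕ) : ((K : Type) ≃ₐ[ℚ] (K : Type))) : (K : Type) →+* (K : Type)) ∈ R.Φ.1 ↔ (k : ℕ) < 4) ∧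
      R.p = σ₀.comp ((g ^ (a : ℕ) : ((K : Type) ≃ₐ[ℚ] (K : Type))) : (K : Type) →+* (K : Type)) ∧ R.p' = σ₀.comp ((g ^ (b : ℕ) : ((K : Type) ≃ₐ[ℚ] (K : Type))) : (K : Type) →+* (K : Type)) := by
  obtain ⟨ε, hε, hpow, hconj⟩ := exists_autEnum_of_generator K hK hg σ₀
  obtain ⟨c, hc⟩ := FaceCensus.exists_conjAut σ₀
  obtain ⟨e, hmul, he⟩ := FaceCensus.exists_enum_of_autEnum Γ σ₀ ε hε
  have hconj' : e conjT = Γ.conj := by rw [FaceCensus.conjT_eq_translate σ₀, ← hc, he, hconj c hc]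
  obtain ⟨R₀, hT₀, -, -⟩ := FaceCensus.exists_face_reads Γ e hmul hconj' σ₀ (r := (15, 17, 34)) (by decide +kernel)
  have hne : InfinitePlace.mk (σ₀.comp ((g ^ (a : ℕ) : ((K : Type) ≃ₐ[ℚ] (K : Type))) : (K : Type) →+* (K : Type))) ≠ InfinitePlace.mk (σ₀.comp ((g ^ (b : ℕ) : ((K : Type) ≃ₐ[ℚ] (K : Type))) : (K : Type) →+* (K : Type))) := by
    rw [Ne, FaceCensus.mk_comp_eq_mk_comp_iff σ₀ hc]
    rintro (h | h)
    · exact hab.1 (by rw [← hpow a, ← hpow b, h])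
    · exact hab.2 (by rw [← hpow a, ← hpow b, ← h, hε, hconj c hc])
  refine ⟨⟨R₀.Φ, _, _, hne⟩, fun k => ?_, rfl, rfl⟩
  have hk := hT₀.2 (e (translate σ₀ (σ₀.comp ((g ^ (k : ℕ) : ((K : Type) ≃ₐ[ℚ] (K : Type))) : (K : Type) →+* (K : Type)))))
  rw [e.symm_apply_apply, mem_pullType, translate_apply_self, he, hpow] at hk
  exact hk.symm.trans (mem_15_iff k)

/-- **FIELD CLOSURE FROM ONE GENERATOR, type `ℤ/8` (cyclic octic) — CLOSED, headline.**  `K` a Galois CM field of degree `8`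
with CYCLIC Galois group generated by `g`; `σ₀` a base embedding; `Φ₀` the `g`-interval CM type (`σ₀ ∘ g ^ k ∈ Φ₀ ↔ k < 4`); the
ONE face `R₁ = (Φ₀; σ₀∘g^0, σ₀∘g^1)` (they exist: `exists_face_of_generator`).  ONE period witness for each on
the universe of record implies the Hodge conjecture, in every codimension, for every complex abelian variety dominated by a finite
product of abelian varieties realising CM types of CM fields embeddable in `K`.  No enumeration, table or conjugation hypothesis is
left: the dictionary is `exists_autEnum_of_generator`.  (FRAMING: conditional on these face periods; `HC_CM` is NOT proved.)
[cite: Shimura1998, §6.2 Theorem 3 and §6.1 Corollary of Theorem 2 (pp. 41–43)] [cite: Pohlmann1968, Thm. 1]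
[cite: Milne1999LefschetzClasses, Thm. 3.2 and Cor. 4.5] [cite: MumfordAV1970, §19 Thm. 1 and p. 169] -/
theorem hodgeConjectureFor_of_avDominatedBy_isProductOf_of_facePeriod_octicCyclic_gen (K : CMField) [IsGalois ℚ K]
    (hK : Module.finrank ℚ (K : Type) = 8) {g : ((K : Type) ≃ₐ[ℚ] (K : Type))} (hg : ∀ x, x ∈ Subgroup.zpowers g)
    (σ₀ : (K : Type) →+* ℂ) (R₁ : Face K)
    (hΦ₁ : ∀ k : Fin 8, σ₀.comp ((g ^ (k : ℕ) : ((K : Type) ≃ₐ[ℚ] (K : Type))) : (K : Type) →+* (K : Type)) ∈ R₁.Φ.1 ↔ (k : ℕ) < 4)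
    (hp₁ : R₁.p = σ₀.comp ((g ^ (0 : ℕ) : ((K : Type) ≃ₐ[ℚ] (K : Type))) : (K : Type) →+* (K : Type))) (hq₁ : R₁.p' = σ₀.comp ((g ^ (1 : ℕ) : ((K : Type) ≃ₐ[ℚ] (K : Type))) : (K : Type) →+* (K : Type)))
    (h₁ : ∃ ι₁ : K →+* ℂ, R₁.Admissible ι₁ ∧ ∃ (V : HermSpace3 K ι₁) (σ : K →+* ℂ),
      (Model.picardCMUniverse exists_isReal_hodgeModel_holds hodgePQ_independent_of_hodgeModel_holds
        BallQuotient.ballQuotientUniformised_holds cmAbelianVarietyRealised_holds).PeriodNV ι₁ V K R₁.psi σ)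
    {P A : AbelianVariety ℂ} (hP : AbelianVariety.IsProductOf (fun B : AbelianVariety ℂ =>
      ∃ (E : Type) (_ : Field E) (_ : NumberField E) (_ : IsCMField E) (_ : E →+* (K : Type)) (Φ : CMType E)
        (ι : 𝓞 E →+* End B) (θ : E →+* Module.End ℂ (complexBetti B.X 1)),
        IsCMTypeRealisation Φ B ι θ) P)
    (hA : AVDominatedBy A P) : HodgeConjectureFor A.dim A.X := by
  have hn : Nat.card ((K : Type) ≃ₐ[ℚ] (K : Type)) = 8 := (IsGalois.card_aut_eq_finrank ℚ (K : Type)).trans hK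
  obtain ⟨ε, hε, hpow, hconj⟩ := exists_autEnum_of_generator K hK hg σ₀
  obtain ⟨c, hc⟩ := FaceCensus.exists_conjAut σ₀
  refine hodgeConjectureFor_of_avDominatedBy_isProductOf_of_facePeriod_octicCyclic_aut K σ₀ ε hε c hc (hconj c hc) R₁
    (g ^ (0 : ℕ)) (g ^ (1 : ℕ))
    ?_ ?_ ?_ ?_ ?_ h₁ hP hA
  · intro x
    obtain ⟨k, rfl⟩ := FaceCensus.exists_pow_eq_of_generator hg hn x
    rw [hpow, mem_15_iff]
    exact hΦ₁ k
  · exact hp₁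
  · rw [show (0 : ℕ) = ((0 : Fin 8) : ℕ) from rfl, hpow]; decide
  · exact hq₁
  · rw [show (1 : ℕ) = ((1 : Fin 8) : ℕ) from rfl, hpow]; decide

end Summit.HodgeConjecture.CorCM.OcticFaceTransport.Cyclic

namespace Summit.HodgeConjecture.CorCM.DecicFaceTransport.Cyclic

open Summit.HodgeConjecture.CorCM.Census.FaceSquaresModel (mem)
open Summit.HodgeConjecture.CorCM.Census.DecicFaceSquaresCyclic (Γ enum group_spec)

/-- **The dictionary from ONE generator, type `ℤ/10` (cyclic decic; `c = 5`).**  `K` a Galois CM field of degree `10` whose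
Galois group is generated by `g`; `σ₀` any base embedding.  Then there is an enumeration `ε : Aut(K) ≃ Fin 10`, multiplicative for seat b30's
Cayley table, reading `g ^ k ↦ k`, under which THE automorphism inducing complex conjugation at `σ₀` reads `Γ.conj = 5` — proved, not
assumed: it is the unique involution `g ^ 5` (`FaceCensus.exists_enum_of_generator`, `FaceCensus.zmod_ten_involution`). [folklore] -/
theorem exists_autEnum_of_generator (K : CMField) [IsGalois ℚ K] (hK : Module.finrank ℚ (K : Type) = 10)
    {g : ((K : Type) ≃ₐ[ℚ] (K : Type))} (hg : ∀ x, x ∈ Subgroup.zpowers g) (σ₀ : (K : Type) →+* ℂ) :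
    ∃ ε : ((K : Type) ≃ₐ[ℚ] (K : Type)) ≃ Fin 10,
      (∀ x y : ((K : Type) ≃ₐ[ℚ] (K : Type)), ε (x * y) = Γ.mul (ε x) (ε y)) ∧ (∀ k : Fin 10, ε (g ^ (k : ℕ)) = k) ∧
      ∀ c : ((K : Type) ≃ₐ[ℚ] (K : Type)), σ₀.comp (c : (K : Type) →+* (K : Type)) = conjugate σ₀ → ε c = Γ.conj := by
  have hn : Nat.card ((K : Type) ≃ₐ[ℚ] (K : Type)) = 10 := (IsGalois.card_aut_eq_finrank ℚ (K : Type)).trans hK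
  obtain ⟨ε, hε, hread, hinv⟩ := FaceCensus.exists_enum_of_generator Γ enum group_spec.2.1 group_spec.2.2.1 hg hn
  refine ⟨ε, hε, fun k => FaceCensus.enum_pow_eq ε hread k, fun c hc => group_spec.2.2.1 ?_⟩
  obtain ⟨h0, h2⟩ := hinv c (FaceCensus.conjAut_mul_self σ₀ hc) (FaceCensus.conjAut_ne_one σ₀ hc)
  rw [group_spec.2.2.2]
  exact FaceCensus.zmod_ten_involution _ h0 h2

/-- The common base type of the generating representatives, code `31`, is the «`g`-interval» `{k | k < 5}`. [folklore] -/
theorem mem_31_iff : ∀ k : Fin 10, mem k 31 = true ↔ (k : ℕ) < 5 := by decide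

/-- **The generating faces exist (non-vacuity), type `ℤ/10`.**  For `K`, `g`, `σ₀` as above there is a CM type `Φ₀` of `K` reading as the
`g`-interval — `σ₀ ∘ g ^ k ∈ Φ₀ ↔ k < 5` (`0 ≤ k < 10`) — and for any two exponents `a, b` at different places (`b ≠ a`, `b ≠ a + 5`) a
rank-four face `(Φ₀; σ₀ ∘ g ^ a, σ₀ ∘ g ^ b)` with exactly these place representatives. [folklore] -/
theorem exists_face_of_generator (K : CMField) [IsGalois ℚ K] (hK : Module.finrank ℚ (K : Type) = 10)
    {g : ((K : Type) ≃ₐ[ℚ] (K : Type))} (hg : ∀ x, x ∈ Subgroup.zpowers g) (σ₀ : (K : Type) →+* ℂ) (a b : Fin 10)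
    (hab : a ≠ b ∧ Γ.mul Γ.conj a ≠ b) :
    ∃ R : Face K, (∀ k : Fin 10, σ₀.comp ((g ^ (k : ℕ) : ((K : Type) ≃ₐ[ℚ] (K : Type))) : (K : Type) →+* (K : Type)) ∈ R.Φ.1 ↔ (k : ℕ) < 5) ∧
      R.p = σ₀.comp ((g ^ (a : ℕ) : ((K : Type) ≃ₐ[ℚ] (K : Type))) : (K : Type) →+* (K : Type)) ∧ R.p' = σ₀.comp ((g ^ (b : ℕ) : ((K : Type) ≃ₐ[ℚ] (K : Type))) : (K : Type) →+* (K : Type)) := by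
  obtain ⟨ε, hε, hpow, hconj⟩ := exists_autEnum_of_generator K hK hg σ₀
  obtain ⟨c, hc⟩ := FaceCensus.exists_conjAut σ₀
  obtain ⟨e, hmul, he⟩ := FaceCensus.exists_enum_of_autEnum Γ σ₀ ε hε
  have hconj' : e conjT = Γ.conj := by rw [FaceCensus.conjT_eq_translate σ₀, ← hc, he, hconj c hc]
  obtain ⟨R₀, hT₀, -, -⟩ := FaceCensus.exists_face_reads Γ e hmul hconj' σ₀ (r := (31, 33, 66)) (by decide +kernel)
  have hne : InfinitePlace.mk (σ₀.comp ((g ^ (a : ℕ) : ((K : Type) ≃ₐ[ℚ] (K : Type))) : (K : Type) →+* (K : Type))) ≠ InfinitePlace.mk (σ₀.comp ((g ^ (b : ℕ) : ((K : Type) ≃ₐ[ℚ] (K : Type))) : (K : Type) →+* (K : Type))) := by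
    rw [Ne, FaceCensus.mk_comp_eq_mk_comp_iff σ₀ hc]
    rintro (h | h)
    · exact hab.1 (by rw [← hpow a, ← hpow b, h])
    · exact hab.2 (by rw [← hpow a, ← hpow b, ← h, hε, hconj c hc])
  refine ⟨⟨R₀.Φ, _, _, hne⟩, fun k => ?_, rfl, rfl⟩
  have hk := hT₀.2 (e (translate σ₀ (σ₀.comp ((g ^ (k : ℕ) : ((K : Type) ≃ₐ[ℚ] (K : Type))) : (K : Type) →+* (K : Type)))))
  rw [e.symm_apply_apply, mem_pullType, translate_apply_self, he, hpow] at hk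
  exact hk.symm.trans (mem_31_iff k)

/-- **FIELD CLOSURE FROM ONE GENERATOR, type `ℤ/10` (cyclic decic) — CLOSED, headline.**  `K` a Galois CM field of degree `10`
with CYCLIC Galois group generated by `g`; `σ₀` a base embedding; `Φ₀` the `g`-interval CM type (`σ₀ ∘ g ^ k ∈ Φ₀ ↔ k < 5`); the
THREE faces `R₁ = (Φ₀; σ₀∘g^0, σ₀∘g^1)`; `R₂ = (Φ₀; σ₀∘g^0, σ₀∘g^2)`; `R₃ = (Φ₀; σ₀∘g^1, σ₀∘g^3)` (they exist: `exists_face_of_generator`).  ONE period witness for each on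
the universe of record implies the Hodge conjecture, in every codimension, for every complex abelian variety dominated by a finite
product of abelian varieties realising CM types of CM fields embeddable in `K`.  No enumeration, table or conjugation hypothesis is
left: the dictionary is `exists_autEnum_of_generator`.  (FRAMING: conditional on these face periods; `HC_CM` is NOT proved.)
[cite: Shimura1998, §6.2 Theorem 3 and §6.1 Corollary of Theorem 2 (pp. 41–43)] [cite: Pohlmann1968, Thm. 1]
[cite: Milne1999LefschetzClasses, Thm. 3.2 and Cor. 4.5] [cite: MumfordAV1970, §19 Thm. 1 and p. 169] -/
theorem hodgeConjectureFor_of_avDominatedBy_isProductOf_of_facePeriod_decicCyclic_gen (K : CMField) [IsGalois ℚ K]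
    (hK : Module.finrank ℚ (K : Type) = 10) {g : ((K : Type) ≃ₐ[ℚ] (K : Type))} (hg : ∀ x, x ∈ Subgroup.zpowers g)
    (σ₀ : (K : Type) →+* ℂ) (R₁ R₂ R₃ : Face K)
    (hΦ₁ : ∀ k : Fin 10, σ₀.comp ((g ^ (k : ℕ) : ((K : Type) ≃ₐ[ℚ] (K : Type))) : (K : Type) →+* (K : Type)) ∈ R₁.Φ.1 ↔ (k : ℕ) < 5)
    (hp₁ : R₁.p = σ₀.comp ((g ^ (0 : ℕ) : ((K : Type) ≃ₐ[ℚ] (K : Type))) : (K : Type) →+* (K : Type))) (hq₁ : R₁.p' = σ₀.comp ((g ^ (1 : ℕ) : ((K : Type) ≃ₐ[ℚ] (K : Type))) : (K : Type) →+* (K : Type)))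
    (hΦ₂ : ∀ k : Fin 10, σ₀.comp ((g ^ (k : ℕ) : ((K : Type) ≃ₐ[ℚ] (K : Type))) : (K : Type) →+* (K : Type)) ∈ R₂.Φ.1 ↔ (k : ℕ) < 5)
    (hp₂ : R₂.p = σ₀.comp ((g ^ (0 : ℕ) : ((K : Type) ≃ₐ[ℚ] (K : Type))) : (K : Type) →+* (K : Type))) (hq₂ : R₂.p' = σ₀.comp ((g ^ (2 : ℕ) : ((K : Type) ≃ₐ[ℚ] (K : Type))) : (K : Type) →+* (K : Type)))
    (hΦ₃ : ∀ k : Fin 10, σ₀.comp ((g ^ (k : ℕ) : ((K : Type) ≃ₐ[ℚ] (K : Type))) : (K : Type) →+* (K : Type)) ∈ R₃.Φ.1 ↔ (k : ℕ) < 5)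
    (hp₃ : R₃.p = σ₀.comp ((g ^ (1 : ℕ) : ((K : Type) ≃ₐ[ℚ] (K : Type))) : (K : Type) →+* (K : Type))) (hq₃ : R₃.p' = σ₀.comp ((g ^ (3 : ℕ) : ((K : Type) ≃ₐ[ℚ] (K : Type))) : (K : Type) →+* (K : Type)))
    (h₁ : ∃ ι₁ : K →+* ℂ, R₁.Admissible ι₁ ∧ ∃ (V : HermSpace3 K ι₁) (σ : K →+* ℂ),
      (Model.picardCMUniverse exists_isReal_hodgeModel_holds hodgePQ_independent_of_hodgeModel_holds
        BallQuotient.ballQuotientUniformised_holds cmAbelianVarietyRealised_holds).PeriodNV ι₁ V K R₁.psi σ)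
    (h₂ : ∃ ι₁ : K →+* ℂ, R₂.Admissible ι₁ ∧ ∃ (V : HermSpace3 K ι₁) (σ : K →+* ℂ),
      (Model.picardCMUniverse exists_isReal_hodgeModel_holds hodgePQ_independent_of_hodgeModel_holds
        BallQuotient.ballQuotientUniformised_holds cmAbelianVarietyRealised_holds).PeriodNV ι₁ V K R₂.psi σ)
    (h₃ : ∃ ι₁ : K →+* ℂ, R₃.Admissible ι₁ ∧ ∃ (V : HermSpace3 K ι₁) (σ : K →+* ℂ),
      (Model.picardCMUniverse exists_isReal_hodgeModel_holds hodgePQ_independent_of_hodgeModel_holds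
        BallQuotient.ballQuotientUniformised_holds cmAbelianVarietyRealised_holds).PeriodNV ι₁ V K R₃.psi σ)
    {P A : AbelianVariety ℂ} (hP : AbelianVariety.IsProductOf (fun B : AbelianVariety ℂ =>
      ∃ (E : Type) (_ : Field E) (_ : NumberField E) (_ : IsCMField E) (_ : E →+* (K : Type)) (Φ : CMType E)
        (ι : 𝓞 E →+* End B) (θ : E →+* Module.End ℂ (complexBetti B.X 1)),
        IsCMTypeRealisation Φ B ι θ) P)
    (hA : AVDominatedBy A P) : HodgeConjectureFor A.dim A.X := by
  have hn : Nat.card ((K : Type) ≃ₐ[ℚ] (K : Type)) = 10 := (IsGalois.card_aut_eq_finrank ℚ (K : Type)).trans hK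
  obtain ⟨ε, hε, hpow, hconj⟩ := exists_autEnum_of_generator K hK hg σ₀
  obtain ⟨c, hc⟩ := FaceCensus.exists_conjAut σ₀
  refine hodgeConjectureFor_of_avDominatedBy_isProductOf_of_facePeriod_decicCyclic_aut K σ₀ ε hε c hc (hconj c hc) R₁ R₂ R₃
    (g ^ (0 : ℕ)) (g ^ (1 : ℕ)) (g ^ (0 : ℕ)) (g ^ (2 : ℕ)) (g ^ (1 : ℕ)) (g ^ (3 : ℕ))
    ?_ ?_ ?_ ?_ ?_ ?_ ?_ ?_ ?_ ?_ ?_ ?_ ?_ ?_ ?_ h₁ h₂ h₃ hP hA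
  · intro x
    obtain ⟨k, rfl⟩ := FaceCensus.exists_pow_eq_of_generator hg hn x
    rw [hpow, mem_31_iff]
    exact hΦ₁ k
  · exact hp₁
  · rw [show (0 : ℕ) = ((0 : Fin 10) : ℕ) from rfl, hpow]; decide
  · exact hq₁
  · rw [show (1 : ℕ) = ((1 : Fin 10) : ℕ) from rfl, hpow]; decide
  · intro x
    obtain ⟨k, rfl⟩ := FaceCensus.exists_pow_eq_of_generator hg hn x
    rw [hpow, mem_31_iff]
    exact hΦ₂ k
  · exact hp₂
  · rw [show (0 : ℕ) = ((0 : Fin 10) : ℕ) from rfl, hpow]; decide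
  · exact hq₂
  · rw [show (2 : ℕ) = ((2 : Fin 10) : ℕ) from rfl, hpow]; decide
  · intro x
    obtain ⟨k, rfl⟩ := FaceCensus.exists_pow_eq_of_generator hg hn x
    rw [hpow, mem_31_iff]
    exact hΦ₃ k
  · exact hp₃
  · rw [show (1 : ℕ) = ((1 : Fin 10) : ℕ) from rfl, hpow]; decide
  · exact hq₃
  · rw [show (3 : ℕ) = ((3 : Fin 10) : ℕ) from rfl, hpow]; decide

end Summit.HodgeConjecture.CorCM.DecicFaceTransport.Cyclic

namespace Summit.HodgeConjecture.CorCM.DuodecicFaceTransport.Cyclic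

open Summit.HodgeConjecture.CorCM.Census.FaceSquaresModel (mem)
open Summit.HodgeConjecture.CorCM.Census.DuodecicFaceSquaresCyclic (Γ enum group_spec)

/-- **The dictionary from ONE generator, type `ℤ/12` (cyclic duodecic; `c = 6`).**  `K` a Galois CM field of degree `12` whose
Galois group is generated by `g`; `σ₀` any base embedding.  Then there is an enumeration `ε : Aut(K) ≃ Fin 12`, multiplicative for seat b30's
Cayley table, reading `g ^ k ↦ k`, under which THE automorphism inducing complex conjugation at `σ₀` reads `Γ.conj = 6` — proved, not
assumed: it is the unique involution `g ^ 6` (`FaceCensus.exists_enum_of_generator`, `FaceCensus.zmod_twelve_involution`). [folklore] -/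
theorem exists_autEnum_of_generator (K : CMField) [IsGalois ℚ K] (hK : Module.finrank ℚ (K : Type) = 12)
    {g : ((K : Type) ≃ₐ[ℚ] (K : Type))} (hg : ∀ x, x ∈ Subgroup.zpowers g) (σ₀ : (K : Type) →+* ℂ) :
    ∃ ε : ((K : Type) ≃ₐ[ℚ] (K : Type)) ≃ Fin 12,
      (∀ x y : ((K : Type) ≃ₐ[ℚ] (K : Type)), ε (x * y) = Γ.mul (ε x) (ε y)) ∧ (∀ k : Fin 12, ε (g ^ (k : ℕ)) = k) ∧
      ∀ c : ((K : Type) ≃ₐ[ℚ] (K : Type)), σ₀.comp (c : (K : Type) →+* (K : Type)) = conjugate σ₀ → ε c = Γ.conj := by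
  have hn : Nat.card ((K : Type) ≃ₐ[ℚ] (K : Type)) = 12 := (IsGalois.card_aut_eq_finrank ℚ (K : Type)).trans hK
  obtain ⟨ε, hε, hread, hinv⟩ := FaceCensus.exists_enum_of_generator Γ enum group_spec.2.1 group_spec.2.2.1 hg hn
  refine ⟨ε, hε, fun k => FaceCensus.enum_pow_eq ε hread k, fun c hc => group_spec.2.2.1 ?_⟩
  obtain ⟨h0, h2⟩ := hinv c (FaceCensus.conjAut_mul_self σ₀ hc) (FaceCensus.conjAut_ne_one σ₀ hc)
  rw [group_spec.2.2.2]
  exact FaceCensus.zmod_twelve_involution _ h0 h2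

/-- The common base type of the generating representatives, code `63`, is the «`g`-interval» `{k | k < 6}`. [folklore] -/
theorem mem_63_iff : ∀ k : Fin 12, mem k 63 = true ↔ (k : ℕ) < 6 := by decide

/-- **The generating faces exist (non-vacuity), type `ℤ/12`.**  For `K`, `g`, `σ₀` as above there is a CM type `Φ₀` of `K` reading as the
`g`-interval — `σ₀ ∘ g ^ k ∈ Φ₀ ↔ k < 6` (`0 ≤ k < 12`) — and for any two exponents `a, b` at different places (`b ≠ a`, `b ≠ a + 6`) a
rank-four face `(Φ₀; σ₀ ∘ g ^ a, σ₀ ∘ g ^ b)` with exactly these place representatives. [folklore] -/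
theorem exists_face_of_generator (K : CMField) [IsGalois ℚ K] (hK : Module.finrank ℚ (K : Type) = 12)
    {g : ((K : Type) ≃ₐ[ℚ] (K : Type))} (hg : ∀ x, x ∈ Subgroup.zpowers g) (σ₀ : (K : Type) →+* ℂ) (a b : Fin 12)
    (hab : a ≠ b ∧ Γ.mul Γ.conj a ≠ b) :
    ∃ R : Face K, (∀ k : Fin 12, σ₀.comp ((g ^ (k : ℕ) : ((K : Type) ≃ₐ[ℚ] (K : Type))) : (K : Type) →+* (K : Type)) ∈ R.Φ.1 ↔ (k : ℕ) < 6) ∧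
      R.p = σ₀.comp ((g ^ (a : ℕ) : ((K : Type) ≃ₐ[ℚ] (K : Type))) : (K : Type) →+* (K : Type)) ∧ R.p' = σ₀.comp ((g ^ (b : ℕ) : ((K : Type) ≃ₐ[ℚ] (K : Type))) : (K : Type) →+* (K : Type)) := by
  obtain ⟨ε, hε, hpow, hconj⟩ := exists_autEnum_of_generator K hK hg σ₀
  obtain ⟨c, hc⟩ := FaceCensus.exists_conjAut σ₀
  obtain ⟨e, hmul, he⟩ := FaceCensus.exists_enum_of_autEnum Γ σ₀ ε hε
  have hconj' : e conjT = Γ.conj := by rw [FaceCensus.conjT_eq_translate σ₀, ← hc, he, hconj c hc]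
  obtain ⟨R₀, hT₀, -, -⟩ := FaceCensus.exists_face_reads Γ e hmul hconj' σ₀ (r := (63, 65, 130)) (by decide +kernel)
  have hne : InfinitePlace.mk (σ₀.comp ((g ^ (a : ℕ) : ((K : Type) ≃ₐ[ℚ] (K : Type))) : (K : Type) →+* (K : Type))) ≠ InfinitePlace.mk (σ₀.comp ((g ^ (b : ℕ) : ((K : Type) ≃ₐ[ℚ] (K : Type))) : (K : Type) →+* (K : Type))) := by
    rw [Ne, FaceCensus.mk_comp_eq_mk_comp_iff σ₀ hc]
    rintro (h | h)
    · exact hab.1 (by rw [← hpow a, ← hpow b, h])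
    · exact hab.2 (by rw [← hpow a, ← hpow b, ← h, hε, hconj c hc])
  refine ⟨⟨R₀.Φ, _, _, hne⟩, fun k => ?_, rfl, rfl⟩
  have hk := hT₀.2 (e (translate σ₀ (σ₀.comp ((g ^ (k : ℕ) : ((K : Type) ≃ₐ[ℚ] (K : Type))) : (K : Type) →+* (K : Type)))))
  rw [e.symm_apply_apply, mem_pullType, translate_apply_self, he, hpow] at hk
  exact hk.symm.trans (mem_63_iff k)

/-- **FIELD CLOSURE FROM ONE GENERATOR, type `ℤ/12` (cyclic duodecic) — CLOSED, headline.**  `K` a Galois CM field of degree `12`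
with CYCLIC Galois group generated by `g`; `σ₀` a base embedding; `Φ₀` the `g`-interval CM type (`σ₀ ∘ g ^ k ∈ Φ₀ ↔ k < 6`); the
FIVE faces `R₁ = (Φ₀; σ₀∘g^0, σ₀∘g^1)`; `R₂ = (Φ₀; σ₀∘g^0, σ₀∘g^2)`; `R₃ = (Φ₀; σ₀∘g^0, σ₀∘g^3)`; `R₄ = (Φ₀; σ₀∘g^1, σ₀∘g^3)`; `R₅ = (Φ₀; σ₀∘g^2, σ₀∘g^3)` (they exist: `exists_face_of_generator`).  ONE period witness for each on
the universe of record implies the Hodge conjecture, in every codimension, for every complex abelian variety dominated by a finite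
product of abelian varieties realising CM types of CM fields embeddable in `K`.  No enumeration, table or conjugation hypothesis is
left: the dictionary is `exists_autEnum_of_generator`.  (FRAMING: conditional on these face periods; `HC_CM` is NOT proved.)
[cite: Shimura1998, §6.2 Theorem 3 and §6.1 Corollary of Theorem 2 (pp. 41–43)] [cite: Pohlmann1968, Thm. 1]
[cite: Milne1999LefschetzClasses, Thm. 3.2 and Cor. 4.5] [cite: MumfordAV1970, §19 Thm. 1 and p. 169] -/
theorem hodgeConjectureFor_of_avDominatedBy_isProductOf_of_facePeriod_duodecicCyclic_gen (K : CMField) [IsGalois ℚ K]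
    (hK : Module.finrank ℚ (K : Type) = 12) {g : ((K : Type) ≃ₐ[ℚ] (K : Type))} (hg : ∀ x, x ∈ Subgroup.zpowers g)
    (σ₀ : (K : Type) →+* ℂ) (R₁ R₂ R₃ R₄ R₅ : Face K)
    (hΦ₁ : ∀ k : Fin 12, σ₀.comp ((g ^ (k : ℕ) : ((K : Type) ≃ₐ[ℚ] (K : Type))) : (K : Type) →+* (K : Type)) ∈ R₁.Φ.1 ↔ (k : ℕ) < 6)
    (hp₁ : R₁.p = σ₀.comp ((g ^ (0 : ℕ) : ((K : Type) ≃ₐ[ℚ] (K : Type))) : (K : Type) →+* (K : Type))) (hq₁ : R₁.p' = σ₀.comp ((g ^ (1 : ℕ) : ((K : Type) ≃ₐ[ℚ] (K : Type))) : (K : Type) →+* (K : Type)))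
    (hΦ₂ : ∀ k : Fin 12, σ₀.comp ((g ^ (k : ℕ) : ((K : Type) ≃ₐ[ℚ] (K : Type))) : (K : Type) →+* (K : Type)) ∈ R₂.Φ.1 ↔ (k : ℕ) < 6)
    (hp₂ : R₂.p = σ₀.comp ((g ^ (0 : ℕ) : ((K : Type) ≃ₐ[ℚ] (K : Type))) : (K : Type) →+* (K : Type))) (hq₂ : R₂.p' = σ₀.comp ((g ^ (2 : ℕ) : ((K : Type) ≃ₐ[ℚ] (K : Type))) : (K : Type) →+* (K : Type)))
    (hΦ₃ : ∀ k : Fin 12, σ₀.comp ((g ^ (k : ℕ) : ((K : Type) ≃ₐ[ℚ] (K : Type))) : (K : Type) →+* (K : Type)) ∈ R₃.Φ.1 ↔ (k : ℕ) < 6)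
    (hp₃ : R₃.p = σ₀.comp ((g ^ (0 : ℕ) : ((K : Type) ≃ₐ[ℚ] (K : Type))) : (K : Type) →+* (K : Type))) (hq₃ : R₃.p' = σ₀.comp ((g ^ (3 : ℕ) : ((K : Type) ≃ₐ[ℚ] (K : Type))) : (K : Type) →+* (K : Type)))
    (hΦ₄ : ∀ k : Fin 12, σ₀.comp ((g ^ (k : ℕ) : ((K : Type) ≃ₐ[ℚ] (K : Type))) : (K : Type) →+* (K : Type)) ∈ R₄.Φ.1 ↔ (k : ℕ) < 6)
    (hp₄ : R₄.p = σ₀.comp ((g ^ (1 : ℕ) : ((K : Type) ≃ₐ[ℚ] (K : Type))) : (K : Type) →+* (K : Type))) (hq₄ : R₄.p' = σ₀.comp ((g ^ (3 : ℕ) : ((K : Type) ≃ₐ[ℚ] (K : Type))) : (K : Type) →+* (K : Type)))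
    (hΦ₅ : ∀ k : Fin 12, σ₀.comp ((g ^ (k : ℕ) : ((K : Type) ≃ₐ[ℚ] (K : Type))) : (K : Type) →+* (K : Type)) ∈ R₅.Φ.1 ↔ (k : ℕ) < 6)
    (hp₅ : R₅.p = σ₀.comp ((g ^ (2 : ℕ) : ((K : Type) ≃ₐ[ℚ] (K : Type))) : (K : Type) →+* (K : Type))) (hq₅ : R₅.p' = σ₀.comp ((g ^ (3 : ℕ) : ((K : Type) ≃ₐ[ℚ] (K : Type))) : (K : Type) →+* (K : Type)))
    (h₁ : ∃ ι₁ : K →+* ℂ, R₁.Admissible ι₁ ∧ ∃ (V : HermSpace3 K ι₁) (σ : K →+* ℂ),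
      (Model.picardCMUniverse exists_isReal_hodgeModel_holds hodgePQ_independent_of_hodgeModel_holds
        BallQuotient.ballQuotientUniformised_holds cmAbelianVarietyRealised_holds).PeriodNV ι₁ V K R₁.psi σ)
    (h₂ : ∃ ι₁ : K →+* ℂ, R₂.Admissible ι₁ ∧ ∃ (V : HermSpace3 K ι₁) (σ : K →+* ℂ),
      (Model.picardCMUniverse exists_isReal_hodgeModel_holds hodgePQ_independent_of_hodgeModel_holds
        BallQuotient.ballQuotientUniformised_holds cmAbelianVarietyRealised_holds).PeriodNV ι₁ V K R₂.psi σ)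
    (h₃ : ∃ ι₁ : K →+* ℂ, R₃.Admissible ι₁ ∧ ∃ (V : HermSpace3 K ι₁) (σ : K →+* ℂ),
      (Model.picardCMUniverse exists_isReal_hodgeModel_holds hodgePQ_independent_of_hodgeModel_holds
        BallQuotient.ballQuotientUniformised_holds cmAbelianVarietyRealised_holds).PeriodNV ι₁ V K R₃.psi σ)
    (h₄ : ∃ ι₁ : K →+* ℂ, R₄.Admissible ι₁ ∧ ∃ (V : HermSpace3 K ι₁) (σ : K →+* ℂ),
      (Model.picardCMUniverse exists_isReal_hodgeModel_holds hodgePQ_independent_of_hodgeModel_holds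
        BallQuotient.ballQuotientUniformised_holds cmAbelianVarietyRealised_holds).PeriodNV ι₁ V K R₄.psi σ)
    (h₅ : ∃ ι₁ : K →+* ℂ, R₅.Admissible ι₁ ∧ ∃ (V : HermSpace3 K ι₁) (σ : K →+* ℂ),
      (Model.picardCMUniverse exists_isReal_hodgeModel_holds hodgePQ_independent_of_hodgeModel_holds
        BallQuotient.ballQuotientUniformised_holds cmAbelianVarietyRealised_holds).PeriodNV ι₁ V K R₅.psi σ)
    {P A : AbelianVariety ℂ} (hP : AbelianVariety.IsProductOf (fun B : AbelianVariety ℂ =>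
      ∃ (E : Type) (_ : Field E) (_ : NumberField E) (_ : IsCMField E) (_ : E →+* (K : Type)) (Φ : CMType E)
        (ι : 𝓞 E →+* End B) (θ : E →+* Module.End ℂ (complexBetti B.X 1)),
        IsCMTypeRealisation Φ B ι θ) P)
    (hA : AVDominatedBy A P) : HodgeConjectureFor A.dim A.X := by
  have hn : Nat.card ((K : Type) ≃ₐ[ℚ] (K : Type)) = 12 := (IsGalois.card_aut_eq_finrank ℚ (K : Type)).trans hK
  obtain ⟨ε, hε, hpow, hconj⟩ := exists_autEnum_of_generator K hK hg σ₀
  obtain ⟨c, hc⟩ := FaceCensus.exists_conjAut σ₀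
  refine hodgeConjectureFor_of_avDominatedBy_isProductOf_of_facePeriod_duodecicCyclic_aut K σ₀ ε hε c hc (hconj c hc) R₁ R₂ R₃ R₄ R₅
    (g ^ (0 : ℕ)) (g ^ (1 : ℕ)) (g ^ (0 : ℕ)) (g ^ (2 : ℕ)) (g ^ (0 : ℕ)) (g ^ (3 : ℕ)) (g ^ (1 : ℕ)) (g ^ (3 : ℕ)) (g ^ (2 : ℕ)) (g ^ (3 : ℕ))
    ?_ ?_ ?_ ?_ ?_ ?_ ?_ ?_ ?_ ?_ ?_ ?_ ?_ ?_ ?_ ?_ ?_ ?_ ?_ ?_ ?_ ?_ ?_ ?_ ?_ h₁ h₂ h₃ h₄ h₅ hP hA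
  · intro x
    obtain ⟨k, rfl⟩ := FaceCensus.exists_pow_eq_of_generator hg hn x
    rw [hpow, mem_63_iff]
    exact hΦ₁ k
  · exact hp₁
  · rw [show (0 : ℕ) = ((0 : Fin 12) : ℕ) from rfl, hpow]; decide
  · exact hq₁
  · rw [show (1 : ℕ) = ((1 : Fin 12) : ℕ) from rfl, hpow]; decide
  · intro x
    obtain ⟨k, rfl⟩ := FaceCensus.exists_pow_eq_of_generator hg hn x
    rw [hpow, mem_63_iff]
    exact hΦ₂ k
  · exact hp₂
  · rw [show (0 : ℕ) = ((0 : Fin 12) : ℕ) from rfl, hpow]; decide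
  · exact hq₂
  · rw [show (2 : ℕ) = ((2 : Fin 12) : ℕ) from rfl, hpow]; decide
  · intro x
    obtain ⟨k, rfl⟩ := FaceCensus.exists_pow_eq_of_generator hg hn x
    rw [hpow, mem_63_iff]
    exact hΦ₃ k
  · exact hp₃
  · rw [show (0 : ℕ) = ((0 : Fin 12) : ℕ) from rfl, hpow]; decide
  · exact hq₃
  · rw [show (3 : ℕ) = ((3 : Fin 12) : ℕ) from rfl, hpow]; decide
  · intro x
    obtain ⟨k, rfl⟩ := FaceCensus.exists_pow_eq_of_generator hg hn x
    rw [hpow, mem_63_iff]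
    exact hΦ₄ k
  · exact hp₄
  · rw [show (1 : ℕ) = ((1 : Fin 12) : ℕ) from rfl, hpow]; decide
  · exact hq₄
  · rw [show (3 : ℕ) = ((3 : Fin 12) : ℕ) from rfl, hpow]; decide
  · intro x
    obtain ⟨k, rfl⟩ := FaceCensus.exists_pow_eq_of_generator hg hn x
    rw [hpow, mem_63_iff]
    exact hΦ₅ k
  · exact hp₅
  · rw [show (2 : ℕ) = ((2 : Fin 12) : ℕ) from rfl, hpow]; decide
  · exact hq₅
  · rw [show (3 : ℕ) = ((3 : Fin 12) : ℕ) from rfl, hpow]; decide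

end Summit.HodgeConjecture.CorCM.DuodecicFaceTransport.Cyclic

end
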